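import Mathlib

/-!
# `stub_altFixing_orbit_dichotomy` — helper lemmas AND full assembly (stub-ideation k = 2, planner-sidea-…-stub_altFixing-2-0)

SORRY-FREE over `import Mathlib` (lean check rc 0, 0 sorries): Plan A end to end.
Plan A: orbit bound ⇒ stabiliser index < m in `alternatingGroup Ω` ⇒ stabiliser = ⊤
(simplicity of `A_m`, m ≥ 5, Mathlib `alternatingGroup.normal_subgroup_eq_bot_or_eq_top`),
transported to `Perm (Fin n)` along `Equiv.Perm.ofSubtype`.
Plan B (fallback, statements only in the .md): tree DM 5.2B with k = 2 + coatom bootstrap.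
The stub prover copies H1a, H1, H2, H3, H4 (`diagRenameAction`), H5 and the assembly into the
skeleton context (only Mathlib names are used; no tree declaration is needed).
-/

open Equiv Equiv.Perm MulAction

namespace StubIdeas2

section GroupCore

variable {α : Type*} [Fintype α] [DecidableEq α]

/-- H1a: the normal core of a subgroup of finite index `t` has index dividing `t!`
(Cayley action on cosets; three lines as in Mathlib `Subgroup.normal_of_index_eq_minFac_card`). -/
theorem index_normalCore_dvd_factorial {G : Type*} [Group G] (H : Subgroup G) [H.FiniteIndex] :
    H.normalCore.index ∣ H.index.factorial := by
  classical
  rw [Subgroup.normalCore_eq_ker, Subgroup.index_ker, Subgroup.index_eq_card, ← Nat.card_perm]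
  exact Subgroup.card_subgroup_dvd_card (MulAction.toPermHom G (G ⧸ H)).range

/-- H1: `A_m` (`m ≥ 5`) has no proper subgroup of index `< m`. -/
theorem alternatingGroup_eq_top_of_index_lt_card (h5 : 5 ≤ Fintype.card α)
    (H : Subgroup (alternatingGroup α)) (hH : H.index < Fintype.card α) : H = ⊤ := by
  classical
  have hα : 5 ≤ Nat.card α := by rwa [Nat.card_eq_fintype_card]
  haveI : Nontrivial α := by
    rw [← Fintype.one_lt_card_iff_nontrivial]; omega
  haveI : H.normalCore.Normal := Subgroup.normalCore_normal H
  rcases alternatingGroup.normal_subgroup_eq_bot_or_eq_top hα (N := H.normalCore) with hbot | htop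
  · exfalso
    have hdvd := index_normalCore_dvd_factorial H
    rw [hbot, Subgroup.index_bot] at hdvd
    have hle : Nat.card (alternatingGroup α) ≤ H.index.factorial :=
      Nat.le_of_dvd (Nat.factorial_pos _) hdvd
    have h2 := two_mul_nat_card_alternatingGroup (α := α)
    rw [Nat.card_perm] at h2
    simp only [Nat.card_eq_fintype_card] at h2 hle
    set m := Fintype.card α with hm
    have hfac : H.index.factorial ≤ (m - 1).factorial := Nat.factorial_le (by omega)
    have hm' : m * (m - 1).factorial = m.factorial := Nat.mul_factorial_pred (by omega)
    have hpos : 0 < (m - 1).factorial := Nat.factorial_pos _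
    have hmul : m * (m - 1).factorial ≤ 2 * (m - 1).factorial := by
      rw [hm', ← h2]; omega
    have := Nat.le_of_mul_le_mul_right hmul hpos
    omega
  · rw [eq_top_iff, ← htop]
    exact Subgroup.normalCore_le H

/-- H2: an orbit contained in a finset has stabiliser of index at most its cardinality. -/
theorem index_stabilizer_le_card {G β : Type*} [Group G] [MulAction G β] (b : β) (T : Finset β)
    (h : ∀ g : G, g • b ∈ T) : (stabilizer G b).index ≤ T.card := by
  rw [MulAction.index_stabilizer, ← Set.ncard_coe_finset T]
  refine Set.ncard_le_ncard (fun x hx => ?_) T.finite_toSet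
  obtain ⟨g, rfl⟩ := MulAction.mem_orbit_iff.1 hx
  exact h g

/-- H3 (GROUP FORM OF THE STUB, constant 5 instead of 9): for ANY action of `alternatingGroup α`,
a point whose orbit has fewer than `card α` elements is fixed. -/
theorem alternatingGroup_smul_eq_self_of_forall_smul_mem {β : Type*}
    [MulAction (alternatingGroup α) β] (h5 : 5 ≤ Fintype.card α) (b : β) (T : Finset β)
    (hT : T.card < Fintype.card α) (h : ∀ g : alternatingGroup α, g • b ∈ T) :
    ∀ g : alternatingGroup α, g • b = b := by
  have hidx := index_stabilizer_le_card (G := alternatingGroup α) b T h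
  have htop := alternatingGroup_eq_top_of_index_lt_card h5 (stabilizer (alternatingGroup α) b)
    (lt_of_le_of_lt hidx hT)
  intro g
  have hg : g ∈ stabilizer (alternatingGroup α) b := by rw [htop]; exact Subgroup.mem_top g
  exact MulAction.mem_stabilizer_iff.1 hg

/-- B2 (fallback arithmetic for DM 5.2B with `k = 2`). -/
theorem two_mul_pred_lt_choose_two {m : ℕ} (hm : 9 ≤ m) : 2 * (m - 1) < m.choose 2 := by
  rw [Nat.choose_two_right]
  have : 9 * (m - 1) ≤ m * (m - 1) := Nat.mul_le_mul_right _ hm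
  omega

end GroupCore

section Transport

variable {n : ℕ} {K : Type} [CommSemiring K]

/-- H4: the diagonal rename action of `Perm (Fin n)` on `MvPolynomial (Fin n × Fin n) K`
(`one_smul` = `rename_id`, `mul_smul` = `rename_rename`). -/
@[reducible] noncomputable def diagRenameAction (n : ℕ) (K : Type) [CommSemiring K] :
    MulAction (Perm (Fin n)) (MvPolynomial (Fin n × Fin n) K) where
  smul ρ q := MvPolynomial.rename (fun p : Fin n × Fin n => (ρ p.1, ρ p.2)) q
  one_smul q := by
    show MvPolynomial.rename (fun p : Fin n × Fin n => ((1 : Perm (Fin n)) p.1, (1 : Perm (Fin n)) p.2)) q = q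
    exact MvPolynomial.rename_id_apply q
  mul_smul ρ ρ' q := by
    show MvPolynomial.rename (fun p : Fin n × Fin n => ((ρ * ρ') p.1, (ρ * ρ') p.2)) q =
      MvPolynomial.rename (fun p : Fin n × Fin n => (ρ p.1, ρ p.2))
        (MvPolynomial.rename (fun p : Fin n × Fin n => (ρ' p.1, ρ' p.2)) q)
    rw [MvPolynomial.rename_rename]
    rfl

/-- H5: a permutation fixing `X` pointwise is `ofSubtype` of a permutation of the complement, with
the same sign (Mathlib `ofSubtype_subtypePerm`, `sign_subtypePerm`). -/
theorem exists_ofSubtype_eq (X : Finset (Fin n)) (ρ : Perm (Fin n)) (hρ : ∀ x ∈ X, ρ x = x) :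
    ∃ g : Perm {x : Fin n // x ∉ X},
      Equiv.Perm.ofSubtype g = ρ ∧ Equiv.Perm.sign g = Equiv.Perm.sign ρ := by
  classical
  have h₁ : ∀ x, (fun x : Fin n => x ∉ X) (ρ x) ↔ (fun x : Fin n => x ∉ X) x := by
    intro x
    simp only
    constructor
    · intro h hx
      exact h (by rwa [hρ x hx])
    · intro h hx
      have h2 : ρ x = x := ρ.injective (hρ _ hx)
      exact h (by rwa [h2] at hx)
  have h₂ : ∀ x, ρ x ≠ x → (fun x : Fin n => x ∉ X) x := fun x hx hxX => hx (hρ x hxX)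
  exact ⟨ρ.subtypePerm h₁, Equiv.Perm.ofSubtype_subtypePerm h₁ h₂, Equiv.Perm.sign_subtypePerm ρ h₁ h₂⟩

/-- sanity: the stub's renaming map IS Mathlib's diagonal action `fun p => ρ • p` (defeq), so the
lead's `IsAutomorphismExtending.eval_apply` outputs plug in without rewriting. -/
example (ρ : Perm (Fin n)) :
    (fun p : Fin n × Fin n => (ρ p.1, ρ p.2)) = fun p : Fin n × Fin n => ρ • p := rfl

/-- sanity: size of the complement. -/
example (X : Finset (Fin n)) : Fintype.card {x : Fin n // x ∉ X} = n - X.card := by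
  classical
  rw [Fintype.card_subtype_compl, Fintype.card_coe, Fintype.card_fin]

/-- ASSEMBLY (Plan A): helper lemmas ⇒ the stub (verbatim signature), fully proved. -/
theorem stub_altFixing_orbit_dichotomy_of_helpers
    (q : MvPolynomial (Fin n × Fin n) K) (X : Finset (Fin n)) (h8 : X.card + 9 ≤ n)
    (T : Finset (MvPolynomial (Fin n × Fin n) K)) (hT : T.card + X.card < n)
    (horb : ∀ ρ : Equiv.Perm (Fin n), (∀ x ∈ X, ρ x = x) → Equiv.Perm.sign ρ = 1 →
      MvPolynomial.rename (fun p : Fin n × Fin n => (ρ p.1, ρ p.2)) q ∈ T) :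
    ∀ ρ : Equiv.Perm (Fin n), (∀ x ∈ X, ρ x = x) → Equiv.Perm.sign ρ = 1 →
      MvPolynomial.rename (fun p : Fin n × Fin n => (ρ p.1, ρ p.2)) q = q := by
  classical
  letI : MulAction (Perm (Fin n)) (MvPolynomial (Fin n × Fin n) K) := diagRenameAction n K
  let Ω := {x : Fin n // x ∉ X}
  let φ : alternatingGroup Ω →* Perm (Fin n) :=
    (Equiv.Perm.ofSubtype : Perm Ω →* Perm (Fin n)).comp (alternatingGroup Ω).subtype
  letI : MulAction (alternatingGroup Ω) (MvPolynomial (Fin n × Fin n) K) :=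
    MulAction.compHom _ φ
  have hΩ : Fintype.card Ω = n - X.card := by
    rw [Fintype.card_subtype_compl, Fintype.card_coe, Fintype.card_fin]
  have h5 : 5 ≤ Fintype.card Ω := by omega
  have hT' : T.card < Fintype.card Ω := by omega
  -- the even permutations of Ω, extended by the identity on X, keep q inside T
  have hmem : ∀ g : alternatingGroup Ω, g • q ∈ T := by
    intro g
    have hfix : ∀ x ∈ X, (φ g) x = x := fun x hx =>
      Equiv.Perm.ofSubtype_apply_of_not_mem (p := fun x : Fin n => x ∉ X) _ (not_not.mpr hx)
    have hsign : Equiv.Perm.sign (φ g) = 1 := by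
      have := g.2
      rw [Equiv.Perm.mem_alternatingGroup] at this
      simpa [φ, Equiv.Perm.sign_ofSubtype] using this
    exact horb (φ g) hfix hsign
  have key := alternatingGroup_smul_eq_self_of_forall_smul_mem h5 q T hT' hmem
  intro ρ hρ hsign
  obtain ⟨g, hg, hsg⟩ := exists_ofSubtype_eq X ρ hρ
  have hgA : g ∈ alternatingGroup Ω := by
    rw [Equiv.Perm.mem_alternatingGroup, hsg, hsign]
  have := key ⟨g, hgA⟩
  -- unfold the composite action: ⟨g, _⟩ • q = rename (ofSubtype g × ofSubtype g) q = rename (ρ × ρ) q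
  have hact : (⟨g, hgA⟩ : alternatingGroup Ω) • q =
      MvPolynomial.rename (fun p : Fin n × Fin n => (ρ p.1, ρ p.2)) q := by
    rw [← hg]; rfl
  rw [← hact]; exact this

/-- VERBATIM stub signature (payload.stub.signature), closed by the assembly above. -/
example {n : ℕ} {K : Type} [CommSemiring K] (q : MvPolynomial (Fin n × Fin n) K) (X : Finset (Fin n)) (h8 : X.card + 9 ≤ n) (T : Finset (MvPolynomial (Fin n × Fin n) K)) (hT : T.card + X.card < n) (horb : ∀ ρ : Equiv.Perm (Fin n), (∀ x ∈ X, ρ x = x) → Equiv.Perm.sign ρ = 1 → MvPolynomial.rename (fun p : Fin n × Fin n => (ρ p.1, ρ p.2)) q ∈ T) : ∀ ρ : Equiv.Perm (Fin n), (∀ x ∈ X, ρ x = x) → Equiv.Perm.sign ρ = 1 → MvPolynomial.rename (fun p : Fin n × Fin n => (ρ p.1, ρ p.2)) q = q :=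
  stub_altFixing_orbit_dichotomy_of_helpers q X h8 T hT horb

end Transport

end StubIdeas2
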